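import Literature.Analysis.FluidPDE.TaoAveragedScaleFormsAt
import Literature.Analysis.FluidPDE.TaoAveragedRhoSymbol
import HarnessLib

/-!
# Tao 2016, §3.3 with the base triple as a parameter: `ρ_ξ` is a Fourier multiplier of order `0`,
# and the one-point datum `m₁ = ρ_ξ` (no rotation, NO DILATION)

T. Tao, *Finite time blowup for an averaged three-dimensional Navier–Stokes equation*,
J. Amer. Math. Soc. **29** (2016), 601–674 = arXiv:1402.0290v3, §3.3, p. 16: "Let
`ρ(ξ₁) := Σ_{n ∈ ℤ} φ(ε₀⁻²((1+ε₀)^{-n}ξ₁ - ξ₁⁰))` … thus `ρ` is supported on the union of the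
balls `(1+ε₀)ⁿ · B(ξ₁⁰, 2ε₀²)` for `n ∈ ℤ`. Let `ρ(D)` be the associated Fourier multiplier; this
is easily checked to be a Fourier multiplier of order `0`. By Definition 3.4, the bilinear operator
`B_{η,ρ}` defined by `B_{η,ρ}(u,v) := B_η(ρ(D)u, v)` is clearly a complex average of `B_η`."
Sequel of `TaoAveragedRhoSymbol.lean` (the same check at Tao's normalisation (3.7), centre
`ξ₁⁰ = (0,1,0)` of modulus `1`) for the symbol `rhoAt ξ ε₀` of `TaoAveragedScaleFormsAt.lean`, whose
centre `ξ 0` is the first vector of an ARBITRARY base triple with moduli in `[1/2, 2]`. HONEST FRAMING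
(cell harvest/h2-tao-ladder, TAO-LADDER rung M_1 — MODEL statements about Tao's averaged equation):
the printed "easily checked" verification re-run with the centre as a parameter (Remark 3.5: the
argument at a general base triple), for the rung-1 support item `CascadeNoDilOfSingleScaleAt`;
nothing here concerns the true Navier–Stokes equations.

* `rhoBumpAt`, `rhoTermAt` — the bump `φ(|v - ξ 0|/ε₀²)` and its dyadic rescalings; support,
  smoothness, bounded derivatives; `|(1+ε₀)^{-n}|ζ| - |ξ 0|| < 2ε₀²` on the support of the `n`-th term;
* `rhoAt_eventuallyEq_sum`, `contDiffOn_rhoAt` — `ρ_ξ` is locally a finite sum off the origin (the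
  tree's index set `rhoIndexSet`, on the neighbourhood `{2|ζ|/3 < |ζ'| < 3|ζ|/2}`), hence smooth there;
* `rhoAt_active_unique` — at most one dyadic scale is active at each frequency (`|ξ 0| ≥ 1/2`,
  `ε₀ ≤ 1/20`: consecutive scales differ by `1+ε₀ > (|ξ 0|+2ε₀²)/(|ξ 0|-2ε₀²)`);
* `norm_pow_mul_norm_iteratedFDeriv_rhoAt_le`, **`isComplexSymbol_rhoAtC`** — `ρ_ξ ∈ 𝓜₀ ⊗ ℂ` with
  `sup_{ζ ≠ 0} |ζ|ᵏ ‖∇ᵏρ_ξ(ζ)‖ ≤ 3ᵏ sup ‖∇ᵏ rhoBumpAt‖` (scale invariance of (1.10); `λ|ζ| ≤ 3` on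
  the active term);
* **`rhoDatumAt`** (`Ω` a point, `m₁ = ρ_ξ`, `m₂ = m₃ = 1`, `R = id`, `λ = 1`), its slots, and
  `weightedForm_rhoAtMultiplier`: `W`-form`(ρ_ξ(D)u, v, w) = (ρ_ξ W)`-form`(u, v, w)` — whence
  `B_{η,ρ;ξ}(u,v) = B_{η;ξ}(ρ_ξ(D)u, v)` for the symbol forms (used by the Summits-side assembly).

## References

* T. Tao, J. Amer. Math. Soc. 29 (2016), 601–674, arXiv:1402.0290v3, §3.3 p. 16, (1.10), Def. 3.4,
  Remark 3.5 p. 20. Key `Tao2016AveragedNS`.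
-/

noncomputable section

open Set Filter
open scoped ENNReal NNReal Topology

namespace Literature.Analysis.FluidPDE.Tao2016

/-- Local notation for physical / frequency space `ℝ³`. -/
local notation "ℝ³" => EuclideanSpace ℝ (Fin 3)
/-- Local notation for the complexified range `ℂ³`. -/
local notation "ℂ³" => EuclideanSpace ℂ (Fin 3)

variable {ξ : Fin 3 → ℝ³}

/-! ### The single bump `φ(|v - ξ 0|/ε₀²)` -/

/-- The single frequency bump `v ↦ φ(|v - ξ 0|/ε₀²)` whose dyadic rescalings sum to `ρ_ξ`.
[cite: Tao2016AveragedNS, §3.3 p. 16] -/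
def rhoBumpAt (ξ : Fin 3 → ℝ³) (ε₀ : ℝ) (v : ℝ³) : ℝ := freqCutoff (‖v - ξ 0‖ / ε₀ ^ 2)

/-- The `n`-th term of `ρ_ξ` is the bump at the rescaled frequency `(1+ε₀)^{-n} ζ`.
[cite: Tao2016AveragedNS, §3.3 p. 16] -/
theorem rhoAt_eq_tsum_rhoBumpAt (ξ : Fin 3 → ℝ³) (ε₀ : ℝ) (ζ : ℝ³) :
    rhoAt ξ ε₀ ζ = ∑' n : ℤ, rhoBumpAt ξ ε₀ (((1 + ε₀) ^ (-n) : ℝ) • ζ) := rfl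

/-- The bump vanishes off `B(ξ 0, 2ε₀²)`. [cite: Tao2016AveragedNS, §3.3 p. 16] -/
theorem rhoBumpAt_eq_zero {ε₀ : ℝ} (hε : ε₀ ≠ 0) {v : ℝ³} (hv : 2 * ε₀ ^ 2 ≤ ‖v - ξ 0‖) :
    rhoBumpAt ξ ε₀ v = 0 := by
  have hε2 : 0 < ε₀ ^ 2 := by positivity
  refine freqCutoff_eq_zero ?_
  rw [abs_of_nonneg (by positivity), le_div_iff₀ hε2]
  exact hv

/-- The bump equals `1` on `B(ξ 0, ε₀²)`. [cite: Tao2016AveragedNS, §3.3 p. 16] -/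
theorem rhoBumpAt_eq_one {ε₀ : ℝ} (hε : ε₀ ≠ 0) {v : ℝ³} (hv : ‖v - ξ 0‖ ≤ ε₀ ^ 2) :
    rhoBumpAt ξ ε₀ v = 1 := by
  have hε2 : 0 < ε₀ ^ 2 := by positivity
  refine freqCutoff_eq_one ?_
  rw [abs_of_nonneg (by positivity), div_le_one hε2]
  exact hv

/-- If the bump does not vanish then `| |v| - |ξ 0| | < 2ε₀²`. [cite: Tao2016AveragedNS, §3.3 p. 16] -/
theorem abs_norm_sub_lt_of_rhoBumpAt_ne_zero {ε₀ : ℝ} (hε : ε₀ ≠ 0) {v : ℝ³}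
    (hv : rhoBumpAt ξ ε₀ v ≠ 0) : |‖v‖ - ‖ξ 0‖| < 2 * ε₀ ^ 2 := by
  have h : ‖v - ξ 0‖ < 2 * ε₀ ^ 2 := by
    by_contra h'
    exact hv (rhoBumpAt_eq_zero hε (not_lt.1 h'))
  exact (abs_norm_sub_norm_le _ _).trans_lt h

/-- The bump is smooth (constant `1` near `ξ 0`, a composition of smooth maps elsewhere). [folklore] -/
private theorem contDiff_rhoBumpAt {ε₀ : ℝ} (hε : ε₀ ≠ 0) {n : ℕ∞} : ContDiff ℝ n (rhoBumpAt ξ ε₀) := by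
  rw [contDiff_iff_contDiffAt]
  intro v
  by_cases hv : v = ξ 0
  · subst hv
    have hε2 : 0 < ε₀ ^ 2 := by positivity
    have h : rhoBumpAt ξ ε₀ =ᶠ[𝓝 (ξ 0)] fun _ => 1 := by
      filter_upwards [Metric.ball_mem_nhds (ξ 0) hε2] with w hw
      exact rhoBumpAt_eq_one hε (le_of_lt (by simpa [dist_eq_norm] using hw))
    exact contDiffAt_const.congr_of_eventuallyEq h
  · have h1 : ContDiffAt ℝ n (fun w : ℝ³ => ‖w - ξ 0‖ / ε₀ ^ 2) v :=
      ((contDiffAt_id.sub contDiffAt_const).norm ℝ (sub_ne_zero.2 hv)).div_const _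
    exact contDiff_freqCutoff.contDiffAt.comp v h1

/-- The bump has compact support (inside the closed ball of radius `2ε₀²` about `ξ 0`). [folklore] -/
private theorem hasCompactSupport_rhoBumpAt {ε₀ : ℝ} (hε : ε₀ ≠ 0) :
    HasCompactSupport (rhoBumpAt ξ ε₀) := by
  refine HasCompactSupport.intro (isCompact_closedBall (ξ 0) (2 * ε₀ ^ 2)) fun v hv => ?_
  refine rhoBumpAt_eq_zero hε (le_of_lt ?_)
  simpa [Metric.mem_closedBall, dist_eq_norm] using hv

/-- The iterated derivatives of the bump are bounded. [folklore] -/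
private theorem exists_bound_iteratedFDeriv_rhoBumpAt {ε₀ : ℝ} (hε : ε₀ ≠ 0) (k : ℕ) :
    ∃ M : ℝ, 0 ≤ M ∧ ∀ v : ℝ³, ‖iteratedFDeriv ℝ k (rhoBumpAt ξ ε₀) v‖ ≤ M := by
  obtain ⟨M, hM⟩ := ((hasCompactSupport_rhoBumpAt hε).iteratedFDeriv k).exists_bound_of_continuous
    ((contDiff_rhoBumpAt (ξ := ξ) hε (n := ⊤)).continuous_iteratedFDeriv (by exact_mod_cast le_top))
  exact ⟨max M 0, le_max_right _ _, fun v => (hM v).trans (le_max_left _ _)⟩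

/-! ### Local finiteness of `ρ_ξ` off the origin -/

/-- The `n`-th term of `ρ_ξ` as a function of `ζ`. [cite: Tao2016AveragedNS, §3.3 p. 16] -/
def rhoTermAt (ξ : Fin 3 → ℝ³) (ε₀ : ℝ) (n : ℤ) (ζ : ℝ³) : ℝ :=
  rhoBumpAt ξ ε₀ (((1 + ε₀) ^ (-n) : ℝ) • ζ)

/-- `ρ_ξ = Σₙ rhoTermAt n`. [cite: Tao2016AveragedNS, §3.3 p. 16] -/
theorem rhoAt_eq_tsum_rhoTermAt (ξ : Fin 3 → ℝ³) (ε₀ : ℝ) (ζ : ℝ³) :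
    rhoAt ξ ε₀ ζ = ∑' n : ℤ, rhoTermAt ξ ε₀ n ζ := rfl

/-- A non-vanishing term pins the rescaled modulus: `|(1+ε₀)^{-n}|ζ| - |ξ 0|| < 2ε₀²`.
[cite: Tao2016AveragedNS, §3.3 p. 16] -/
theorem abs_sub_lt_of_rhoTermAt_ne_zero {ε₀ : ℝ} (hε : 0 < ε₀) {n : ℤ} {ζ : ℝ³}
    (h : rhoTermAt ξ ε₀ n ζ ≠ 0) : |(1 + ε₀) ^ (-n) * ‖ζ‖ - ‖ξ 0‖| < 2 * ε₀ ^ 2 := by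
  have h' := abs_norm_sub_lt_of_rhoBumpAt_ne_zero hε.ne' h
  rwa [norm_smul, Real.norm_eq_abs, abs_of_pos (zpow_pos (show (0 : ℝ) < 1 + ε₀ by linarith) _)] at h'

/-- Off the tree's finite index set `rhoIndexSet ε₀ ζ` the terms vanish on the neighbourhood
`{2|ζ|/3 < |ζ'| < 3|ζ|/2}` (`|ξ 0| ∈ [1/2, 2]`, `0 < ε₀ ≤ 1/20`). [cite: Tao2016AveragedNS, §3.3 p. 16] -/
theorem rhoTermAt_eq_zero_of_not_mem (hξ : ∀ j, 1 / 2 ≤ ‖ξ j‖ ∧ ‖ξ j‖ ≤ 2) {ε₀ : ℝ} (hε : 0 < ε₀)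
    (hε' : ε₀ ≤ 1 / 20) {ζ ζ' : ℝ³} (h₁ : 2 * ‖ζ‖ / 3 < ‖ζ'‖) (h₂ : ‖ζ'‖ < 3 * ‖ζ‖ / 2) {n : ℤ}
    (hn : n ∉ rhoIndexSet ε₀ ζ) : rhoTermAt ξ ε₀ n ζ' = 0 := by
  by_contra hne
  have h := abs_sub_lt_of_rhoTermAt_ne_zero hε hne
  have hε2 : 2 * ε₀ ^ 2 ≤ 1 / 200 := by nlinarith
  obtain ⟨hN, hN'⟩ := hξ 0
  rw [abs_lt] at h
  have hl : 0 < (1 + ε₀) ^ (-n) := zpow_pos (by linarith) _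
  apply hn
  constructor
  · nlinarith [mul_le_mul_of_nonneg_left h₂.le hl.le]
  · nlinarith [mul_le_mul_of_nonneg_left h₁.le hl.le]

/-- **`ρ_ξ` is locally a finite sum off the origin.** [cite: Tao2016AveragedNS, §3.3 p. 16] -/
theorem rhoAt_eventuallyEq_sum (hξ : ∀ j, 1 / 2 ≤ ‖ξ j‖ ∧ ‖ξ j‖ ≤ 2) {ε₀ : ℝ} (hε : 0 < ε₀)
    (hε' : ε₀ ≤ 1 / 20) {ζ : ℝ³} (hζ : ζ ≠ 0) :
    rhoAt ξ ε₀ =ᶠ[𝓝 ζ] fun ζ' => ∑ n ∈ (rhoIndexSet_finite hε hζ).toFinset, rhoTermAt ξ ε₀ n ζ' := by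
  have hnorm : 0 < ‖ζ‖ := norm_pos_iff.2 hζ
  have hU : {ζ' : ℝ³ | 2 * ‖ζ‖ / 3 < ‖ζ'‖ ∧ ‖ζ'‖ < 3 * ‖ζ‖ / 2} ∈ 𝓝 ζ := by
    refine (IsOpen.and (isOpen_lt continuous_const continuous_norm)
      (isOpen_lt continuous_norm continuous_const)).mem_nhds ⟨by linarith, by linarith⟩
  filter_upwards [hU] with ζ' hζ'
  rw [rhoAt_eq_tsum_rhoTermAt]
  refine tsum_eq_sum fun n hn => ?_
  rw [Set.Finite.mem_toFinset] at hn
  exact rhoTermAt_eq_zero_of_not_mem hξ hε hε' hζ'.1 hζ'.2 hn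

/-- Each term is smooth. [folklore] -/
private theorem contDiff_rhoTermAt {ε₀ : ℝ} (hε : ε₀ ≠ 0) (n : ℤ) {m : ℕ∞} :
    ContDiff ℝ m (rhoTermAt ξ ε₀ n) :=
  (contDiff_rhoBumpAt hε).comp (contDiff_const_smul _)

/-- **`ρ_ξ` is smooth off the origin.** [cite: Tao2016AveragedNS, §3.3 p. 16] -/
theorem contDiffOn_rhoAt (hξ : ∀ j, 1 / 2 ≤ ‖ξ j‖ ∧ ‖ξ j‖ ≤ 2) {ε₀ : ℝ} (hε : 0 < ε₀)
    (hε' : ε₀ ≤ 1 / 20) : ContDiffOn ℝ ((⊤ : ℕ∞) : WithTop ℕ∞) (rhoAt ξ ε₀) {0}ᶜ := by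
  intro ζ hζ
  have h := rhoAt_eventuallyEq_sum hξ hε hε' (ζ := ζ) hζ
  refine (ContDiffAt.congr_of_eventuallyEq ?_ h).contDiffWithinAt
  exact ContDiffAt.sum fun n _ => (contDiff_rhoTermAt hε.ne' n).contDiffAt

/-! ### Iterated derivatives of `ρ_ξ` -/

/-- The iterated derivative of `ρ_ξ` at `ζ ≠ 0` is the finite sum of those of the terms. [folklore] -/
private theorem iteratedFDeriv_rhoAt (hξ : ∀ j, 1 / 2 ≤ ‖ξ j‖ ∧ ‖ξ j‖ ≤ 2) {ε₀ : ℝ} (hε : 0 < ε₀)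
    (hε' : ε₀ ≤ 1 / 20) {ζ : ℝ³} (hζ : ζ ≠ 0) (k : ℕ) :
    iteratedFDeriv ℝ k (rhoAt ξ ε₀) ζ =
      ∑ n ∈ (rhoIndexSet_finite hε hζ).toFinset, iteratedFDeriv ℝ k (rhoTermAt ξ ε₀ n) ζ := by
  rw [((rhoAt_eventuallyEq_sum hξ hε hε' hζ).iteratedFDeriv (𝕜 := ℝ) k).eq_of_nhds]
  exact iteratedFDeriv_fun_sum_apply fun n _ => (contDiff_rhoTermAt hε.ne' n).contDiffAt

/-- Scale invariance of the seminorms: `‖∇ᵏ[g(λ·)](ζ)‖ ≤ λᵏ ‖(∇ᵏg)(λζ)‖` (`λ > 0`).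
[cite: Tao2016AveragedNS, (1.10)] -/
theorem norm_iteratedFDeriv_rhoTermAt_le {ε₀ : ℝ} (hε : 0 < ε₀) (n : ℤ) (ζ : ℝ³) (k : ℕ) :
    ‖iteratedFDeriv ℝ k (rhoTermAt ξ ε₀ n) ζ‖ ≤
      ((1 + ε₀) ^ (-n)) ^ k * ‖iteratedFDeriv ℝ k (rhoBumpAt ξ ε₀) (((1 + ε₀) ^ (-n) : ℝ) • ζ)‖ := by
  have hl : 0 < (1 + ε₀) ^ (-n) := zpow_pos (by linarith) _
  have hcomp : rhoTermAt ξ ε₀ n =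
      rhoBumpAt ξ ε₀ ∘ (((1 + ε₀) ^ (-n) : ℝ) • ContinuousLinearMap.id ℝ ℝ³) := by
    funext ζ
    rfl
  rw [hcomp, ContinuousLinearMap.iteratedFDeriv_comp_right _ (contDiff_rhoBumpAt hε.ne') ζ
    (by exact_mod_cast le_top)]
  refine (ContinuousMultilinearMap.norm_compContinuousLinearMap_le _ _).trans ?_
  rw [Finset.prod_const, Finset.card_univ, Fintype.card_fin, mul_comm]
  gcongr
  · rw [norm_smul, Real.norm_eq_abs, abs_of_pos hl]
    exact mul_le_of_le_one_right hl.le ContinuousLinearMap.norm_id_le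
  · rfl

/-- The iterated derivatives of the bump vanish off the closed ball of radius `2ε₀²` about `ξ 0`. [folklore] -/
private theorem iteratedFDeriv_rhoBumpAt_eq_zero {ε₀ : ℝ} (hε : ε₀ ≠ 0) {v : ℝ³}
    (hv : 2 * ε₀ ^ 2 < ‖v - ξ 0‖) (k : ℕ) : iteratedFDeriv ℝ k (rhoBumpAt ξ ε₀) v = 0 := by
  have hnot : v ∉ tsupport (rhoBumpAt ξ ε₀) := by
    intro hmem
    have hsub : tsupport (rhoBumpAt ξ ε₀) ⊆ {w : ℝ³ | ‖w - ξ 0‖ ≤ 2 * ε₀ ^ 2} :=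
      closure_minimal (fun w hw => by
        by_contra h'
        exact hw (rhoBumpAt_eq_zero hε (not_le.1 h').le)) (isClosed_le (continuous_norm.comp
          (continuous_id.sub continuous_const)) continuous_const)
    exact (not_le.2 hv) (hsub hmem)
  exact image_eq_zero_of_notMem_tsupport fun hmem => hnot (tsupport_iteratedFDeriv_subset k hmem)

/-! ### At most one active scale, and the seminorm bound -/

/-- **At most one dyadic scale is active at each frequency** (`|ξ 0| ≥ 1/2`, `0 < ε₀ ≤ 1/20`): if
`|(1+ε₀)^{-n}|ζ| - |ξ 0|| ≤ 2ε₀²` and `|(1+ε₀)^{-n'}|ζ| - |ξ 0|| ≤ 2ε₀²` then `n = n'`.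
[cite: Tao2016AveragedNS, §3.3 p. 16] -/
theorem rhoAt_active_unique (hξ : ∀ j, 1 / 2 ≤ ‖ξ j‖ ∧ ‖ξ j‖ ≤ 2) {ε₀ : ℝ} (hε : 0 < ε₀)
    (hε' : ε₀ ≤ 1 / 20) {ζ : ℝ³} {n n' : ℤ}
    (hn : |(1 + ε₀) ^ (-n) * ‖ζ‖ - ‖ξ 0‖| ≤ 2 * ε₀ ^ 2)
    (hn' : |(1 + ε₀) ^ (-n') * ‖ζ‖ - ‖ξ 0‖| ≤ 2 * ε₀ ^ 2) : n = n' := by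
  have ha : 1 ≤ 1 + ε₀ := by linarith
  have ha0 : 0 < 1 + ε₀ := by linarith
  obtain ⟨hN, -⟩ := hξ 0
  rw [abs_le] at hn hn'
  have key : ∀ {m m' : ℤ}, m < m' →
      -(2 * ε₀ ^ 2) ≤ (1 + ε₀) ^ (-m') * ‖ζ‖ - ‖ξ 0‖ →
        (1 + ε₀) ^ (-m) * ‖ζ‖ - ‖ξ 0‖ ≤ 2 * ε₀ ^ 2 → False := by
    intro m m' hlt hlo hhi
    have hstep : (1 + ε₀) * (1 + ε₀) ^ (-m') ≤ (1 + ε₀) ^ (-m) := by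
      rw [← zpow_one_add₀ ha0.ne']
      exact zpow_le_zpow_right₀ ha (by omega)
    have hpos : 0 ≤ (1 + ε₀) ^ (-m') * ‖ζ‖ := mul_nonneg (zpow_pos ha0 _).le (norm_nonneg _)
    have h1 : (1 + ε₀) * ((1 + ε₀) ^ (-m') * ‖ζ‖) ≤ (1 + ε₀) ^ (-m) * ‖ζ‖ := by
      rw [← mul_assoc]
      exact mul_le_mul_of_nonneg_right hstep (norm_nonneg _)
    nlinarith
  rcases lt_trichotomy n n' with h | h | h
  · exact (key h hn'.1 hn.2).elim
  · exact h
  · exact (key h hn.1 hn'.2).elim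

/-- **The seminorm bound**: `|ζ|ᵏ ‖∇ᵏρ_ξ(ζ)‖ ≤ 3ᵏ M_k` for `ζ ≠ 0`, with `M_k` a bound for
`‖∇ᵏ rhoBumpAt‖` (`|ξ 0| ∈ [1/2, 2]`, `0 < ε₀ ≤ 1/20`; `λ|ζ| ≤ |ξ 0| + 2ε₀² ≤ 3` on the active term).
[cite: Tao2016AveragedNS, §3.3 p. 16 and (1.10)] -/
theorem norm_pow_mul_norm_iteratedFDeriv_rhoAt_le (hξ : ∀ j, 1 / 2 ≤ ‖ξ j‖ ∧ ‖ξ j‖ ≤ 2) {ε₀ : ℝ}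
    (hε : 0 < ε₀) (hε' : ε₀ ≤ 1 / 20) {ζ : ℝ³} (hζ : ζ ≠ 0) (k : ℕ) {M : ℝ} (hM0 : 0 ≤ M)
    (hM : ∀ v : ℝ³, ‖iteratedFDeriv ℝ k (rhoBumpAt ξ ε₀) v‖ ≤ M) :
    ‖ζ‖ ^ k * ‖iteratedFDeriv ℝ k (rhoAt ξ ε₀) ζ‖ ≤ 3 ^ k * M := by
  have ha0 : 0 < 1 + ε₀ := by linarith
  obtain ⟨-, hN'⟩ := hξ 0
  set S := (rhoIndexSet_finite hε hζ).toFinset with hS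
  set P : ℤ → Prop := fun n => |(1 + ε₀) ^ (-n) * ‖ζ‖ - ‖ξ 0‖| ≤ 2 * ε₀ ^ 2 with hP
  have hterm : ∀ n, ‖iteratedFDeriv ℝ k (rhoTermAt ξ ε₀ n) ζ‖ ≤
      if P n then ((1 + ε₀) ^ (-n)) ^ k * M else 0 := by
    intro n
    by_cases hPn : P n
    · rw [if_pos hPn]
      exact (norm_iteratedFDeriv_rhoTermAt_le hε n ζ k).trans
        (mul_le_mul_of_nonneg_left (hM _) (pow_nonneg (zpow_pos ha0 _).le _))
    · rw [if_neg hPn]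
      refine (norm_iteratedFDeriv_rhoTermAt_le hε n ζ k).trans (le_of_eq ?_)
      rw [iteratedFDeriv_rhoBumpAt_eq_zero hε.ne' ?_ k, norm_zero, mul_zero]
      by_contra hle
      apply hPn
      have hle' : ‖((1 + ε₀) ^ (-n) : ℝ) • ζ - ξ 0‖ ≤ 2 * ε₀ ^ 2 := not_lt.1 hle
      calc |(1 + ε₀) ^ (-n) * ‖ζ‖ - ‖ξ 0‖| = |‖((1 + ε₀) ^ (-n) : ℝ) • ζ‖ - ‖ξ 0‖| := by
            rw [norm_smul, Real.norm_eq_abs, abs_of_pos (zpow_pos ha0 _)]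
        _ ≤ ‖((1 + ε₀) ^ (-n) : ℝ) • ζ - ξ 0‖ := abs_norm_sub_norm_le _ _
        _ ≤ 2 * ε₀ ^ 2 := hle'
  have hcard : (S.filter P).card ≤ 1 :=
    Finset.card_le_one.2 fun a ha b hb =>
      rhoAt_active_unique hξ hε hε' (Finset.mem_filter.1 ha).2 (Finset.mem_filter.1 hb).2
  have hact : ∀ n, P n → ‖ζ‖ * (1 + ε₀) ^ (-n) ≤ 3 := by
    intro n hPn
    have h := (abs_le.1 hPn).2
    nlinarith [sq_nonneg ε₀]
  calc ‖ζ‖ ^ k * ‖iteratedFDeriv ℝ k (rhoAt ξ ε₀) ζ‖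
      = ‖ζ‖ ^ k * ‖∑ n ∈ S, iteratedFDeriv ℝ k (rhoTermAt ξ ε₀ n) ζ‖ := by
        rw [iteratedFDeriv_rhoAt hξ hε hε' hζ k]
    _ ≤ ‖ζ‖ ^ k * ∑ n ∈ S, (if P n then ((1 + ε₀) ^ (-n)) ^ k * M else 0) := by
        gcongr
        exact (norm_sum_le _ _).trans (Finset.sum_le_sum fun n _ => hterm n)
    _ = ∑ n ∈ S.filter P, ‖ζ‖ ^ k * (((1 + ε₀) ^ (-n)) ^ k * M) := by
        rw [Finset.sum_filter, Finset.mul_sum]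
        refine Finset.sum_congr rfl fun n _ => ?_
        split_ifs <;> simp
    _ ≤ ∑ n ∈ S.filter P, 3 ^ k * M := by
        refine Finset.sum_le_sum fun n hn => ?_
        have hPn := (Finset.mem_filter.1 hn).2
        rw [← mul_assoc, ← mul_pow]
        exact mul_le_mul_of_nonneg_right (pow_le_pow_left₀ (by positivity) (hact n hPn) k) hM0
    _ = (S.filter P).card * (3 ^ k * M) := by rw [Finset.sum_const, nsmul_eq_mul]
    _ ≤ 1 * (3 ^ k * M) := by
        gcongr
        exact_mod_cast hcard
    _ = 3 ^ k * M := one_mul _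

/-! ### `ρ_ξ ∈ 𝓜₀ ⊗ ℂ` -/

/-- The complexified symbol `ζ ↦ (ρ_ξ(ζ) : ℂ)`. [cite: Tao2016AveragedNS, §3.3 p. 16] -/
def rhoAtC (ξ : Fin 3 → ℝ³) (ε₀ : ℝ) (ζ : ℝ³) : ℂ := (rhoAt ξ ε₀ ζ : ℂ)

/-- Norms of iterated derivatives of the complexified symbol off the origin. [folklore] -/
private theorem norm_iteratedFDeriv_rhoAtC (hξ : ∀ j, 1 / 2 ≤ ‖ξ j‖ ∧ ‖ξ j‖ ≤ 2) {ε₀ : ℝ}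
    (hε : 0 < ε₀) (hε' : ε₀ ≤ 1 / 20) {ζ : ℝ³} (hζ : ζ ≠ 0) (k : ℕ) :
    ‖iteratedFDeriv ℝ k (rhoAtC ξ ε₀) ζ‖ = ‖iteratedFDeriv ℝ k (rhoAt ξ ε₀) ζ‖ := by
  have hopen : IsOpen ({0}ᶜ : Set ℝ³) := isOpen_compl_singleton
  have hmem : ζ ∈ ({0}ᶜ : Set ℝ³) := hζ
  rw [← iteratedFDerivWithin_of_isOpen k hopen hmem, ← iteratedFDerivWithin_of_isOpen k hopen hmem]
  have hcd : ContDiffWithinAt ℝ k (rhoAt ξ ε₀) ({0}ᶜ : Set ℝ³) ζ :=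
    ((contDiffOn_rhoAt hξ hε hε').of_le (by exact_mod_cast le_top)) ζ hmem
  exact Complex.ofRealLI.norm_iteratedFDerivWithin_comp_left (f := rhoAt ξ ε₀) hcd hopen.uniqueDiffOn
    hmem (i := k) le_rfl

/-- **`ρ_ξ(D)` is a (complex) Fourier multiplier of order `0`** ("easily checked", Tao p. 16):
`ρ_ξ` is smooth off the origin and all seminorms (1.10) are finite, for base moduli in `[1/2, 2]` and
`0 < ε₀ ≤ 1/20`. [cite: Tao2016AveragedNS, §3.3 p. 16] -/
theorem isComplexSymbol_rhoAtC (hξ : ∀ j, 1 / 2 ≤ ‖ξ j‖ ∧ ‖ξ j‖ ≤ 2) {ε₀ : ℝ} (hε : 0 < ε₀)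
    (hε' : ε₀ ≤ 1 / 20) : IsComplexSymbol (rhoAtC ξ ε₀) := by
  refine ⟨Complex.ofRealCLM.contDiff.comp_contDiffOn (contDiffOn_rhoAt hξ hε hε'), fun k => ?_⟩
  obtain ⟨M, hM0, hM⟩ := exists_bound_iteratedFDeriv_rhoBumpAt (ξ := ξ) hε.ne' k
  refine lt_of_le_of_lt (iSup₂_le fun ζ hζ => ?_) (ENNReal.ofReal_lt_top (r := 3 ^ k * M))
  have hζ' : ζ ≠ 0 := hζ
  have h := norm_pow_mul_norm_iteratedFDeriv_rhoAt_le hξ hε hε' hζ' k hM0 hM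
  rw [← norm_iteratedFDeriv_rhoAtC hξ hε hε' hζ' k] at h
  calc (‖ζ‖₊ : ℝ≥0∞) ^ k * ‖iteratedFDeriv ℝ k (rhoAtC ξ ε₀) ζ‖₊
      = ENNReal.ofReal (‖ζ‖ ^ k * ‖iteratedFDeriv ℝ k (rhoAtC ξ ε₀) ζ‖) := by
        rw [ENNReal.ofReal_mul (by positivity), ENNReal.ofReal_pow (norm_nonneg _), ofReal_norm,
          ofReal_norm, enorm_eq_nnnorm, enorm_eq_nnnorm]
    _ ≤ ENNReal.ofReal (3 ^ k * M) := ENNReal.ofReal_le_ofReal h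

/-! ### The one-point datum `m₁ = ρ_ξ` -/

open MeasureTheory

/-- **The one-point complex datum of §3.3 about `ξ`**: `Ω` a point, `m₁ = ρ_ξ`, `m₂ = m₃ = 1`, no
rotation, no dilation ("`B_{η,ρ}(u,v) := B_η(ρ(D)u, v)` is clearly a complex average of `B_η`").
[cite: Tao2016AveragedNS, §3.3 p. 16] -/
def rhoDatumAt (hξ : ∀ j, 1 / 2 ≤ ‖ξ j‖ ∧ ‖ξ j‖ ≤ 2) {ε₀ : ℝ} (hε : 0 < ε₀) (hε' : ε₀ ≤ 1 / 20) :
    ComplexAveragingDatum where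
  Ω := Unit
  μ := Measure.dirac ()
  m i _ := if i = 0 then rhoAtC ξ ε₀ else fun _ => 1
  R _ _ := LinearIsometryEquiv.refl ℝ _
  lam _ _ := 1
  isComplexSymbol i _ := by
    by_cases hi : i = 0
    · simp only [hi, if_true]
      exact isComplexSymbol_rhoAtC hξ hε hε'
    · simp only [hi, if_false]
      exact isComplexSymbol_const 1
  det_R _ _ := LinearMap.det_id
  lam_pos _ _ := one_pos
  lam_bdd := ⟨1, fun _ _ => by norm_num⟩
  moment k₁ k₂ k₃ := by
    rw [lintegral_dirac]
    simp only [if_true, show (1 : Fin 3) ≠ 0 by decide, show (2 : Fin 3) ≠ 0 by decide, if_false]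
    exact ENNReal.mul_lt_top (ENNReal.mul_lt_top ((isComplexSymbol_rhoAtC hξ hε hε').2 k₁)
      ((isComplexSymbol_const 1).2 k₂)) ((isComplexSymbol_const 1).2 k₃)
  measurable_m _ _ _ := measurable_const
  measurable_R _ _ := measurable_const
  measurable_lam _ := measurable_const

/-- The dilation factors of the one-point datum are `1`. [cite: Tao2016AveragedNS, §3.3 p. 16] -/
theorem rhoDatumAt_lam (hξ : ∀ j, 1 / 2 ≤ ‖ξ j‖ ∧ ‖ξ j‖ ≤ 2) {ε₀ : ℝ} (hε : 0 < ε₀)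
    (hε' : ε₀ ≤ 1 / 20) (i : Fin 3) (θ : Unit) : (rhoDatumAt hξ hε hε').lam i θ = 1 := rfl

/-- Slot `0` of the one-point datum is `ρ_ξ(D)`. [cite: Tao2016AveragedNS, §3.3 p. 16] -/
theorem rhoDatumAt_slot_zero (hξ : ∀ j, 1 / 2 ≤ ‖ξ j‖ ∧ ‖ξ j‖ ≤ 2) {ε₀ : ℝ} (hε : 0 < ε₀)
    (hε' : ε₀ ≤ 1 / 20) (θ : Unit) (u : L2C) :
    (rhoDatumAt hξ hε hε').slot 0 θ u =
      fourierMultiplier ((isComplexSymbol_rhoAtC hξ hε hε').memLp_top.toLp (rhoAtC ξ ε₀)) u := by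
  unfold ComplexAveragingDatum.slot ComplexAveragingDatum.symbolLp
  rw [show (rhoDatumAt hξ hε hε').lam 0 θ = 1 from rfl, dil_one,
    show (rhoDatumAt hξ hε hε').R 0 θ = LinearIsometryEquiv.refl ℝ _ from rfl, rot_refl]
  rfl

/-- Slots `1, 2` of the one-point datum are the identity. [cite: Tao2016AveragedNS, §3.3 p. 16] -/
theorem rhoDatumAt_slot_of_ne_zero (hξ : ∀ j, 1 / 2 ≤ ‖ξ j‖ ∧ ‖ξ j‖ ≤ 2) {ε₀ : ℝ} (hε : 0 < ε₀)
    (hε' : ε₀ ≤ 1 / 20) {i : Fin 3} (hi : i ≠ 0) (θ : Unit) (u : L2C) :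
    (rhoDatumAt hξ hε hε').slot i θ u = u := by
  unfold ComplexAveragingDatum.slot
  rw [show (rhoDatumAt hξ hε hε').lam i θ = 1 from rfl, dil_one,
    show (rhoDatumAt hξ hε hε').R i θ = LinearIsometryEquiv.refl ℝ _ from rfl, rot_refl]
  have h : (rhoDatumAt hξ hε hε').symbolLp i θ =
      (memLp_top_const (μ := (volume : Measure ℝ³)) (1 : ℂ)).toLp _ := by
    unfold ComplexAveragingDatum.symbolLp
    exact MemLp.toLp_congr _ _ (Eventually.of_forall fun ζ => by
      show (if i = 0 then rhoAtC ξ ε₀ else fun _ => (1 : ℂ)) ζ = 1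
      rw [if_neg hi])
  rw [h, fourierMultiplier_one]

/-- The average over the one-point datum is evaluation at the point. [cite: Tao2016AveragedNS, §3.3 p. 16] -/
theorem rhoDatumAt_average (hξ : ∀ j, 1 / 2 ≤ ‖ξ j‖ ∧ ‖ξ j‖ ≤ 2) {ε₀ : ℝ} (hε : 0 < ε₀)
    (hε' : ε₀ ≤ 1 / 20) (C' : L2C → L2C → L2C → ℂ) (u v w : L2C) :
    (rhoDatumAt hξ hε hε').average C' u v w =
      C' ((rhoDatumAt hξ hε hε').slot 0 () u) ((rhoDatumAt hξ hε hε').slot 1 () v)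
        ((rhoDatumAt hξ hε hε').slot 2 () w) :=
  integral_dirac _ ()

/-- **`W`-form`(ρ_ξ(D)u, v, w) = (ρ_ξ W)`-form`(u, v, w)`** for every real weight `W`
(`\widehat{ρ_ξ(D)u} = ρ_ξ û`; with `W = η_ξ` this is `⟨B_{η,ρ;ξ}(u,v), w⟩ = ⟨B_{η;ξ}(ρ_ξ(D)u, v), w⟩`
for the symbol forms). [cite: Tao2016AveragedNS, §3.3 p. 16] -/
theorem weightedForm_rhoAtMultiplier (hξ : ∀ j, 1 / 2 ≤ ‖ξ j‖ ∧ ‖ξ j‖ ≤ 2) {ε₀ : ℝ} (hε : 0 < ε₀)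
    (hε' : ε₀ ≤ 1 / 20) (W : ℝ³ × ℝ³ → ℝ) (u v w : L2C) :
    weightedForm W
        (fourierMultiplier ((isComplexSymbol_rhoAtC hξ hε hε').memLp_top.toLp (rhoAtC ξ ε₀)) u) v w =
      weightedForm (fun p => rhoAt ξ ε₀ p.1 * W p) u v w := by
  unfold weightedForm
  refine integral_congr_ae ?_
  filter_upwards [Measure.quasiMeasurePreserving_fst.ae_eq
    (fourierFn_fourierMultiplier_toLp (isComplexSymbol_rhoAtC hξ hε hε').memLp_top u)] with p hp
  have hp' : fourierFn (fourierMultiplier ((isComplexSymbol_rhoAtC hξ hε hε').memLp_top.toLp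
      (rhoAtC ξ ε₀)) u) p.1 = rhoAtC ξ ε₀ p.1 • fourierFn u p.1 := hp
  simp only [eulerIntegrand]
  rw [hp', Λ_smul₁, rhoAtC]
  push_cast
  ring

end Literature.Analysis.FluidPDE.Tao2016
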